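import Summits.Schanuel.Schanuel.Theorems.RootDecomp1ELWTransport05

/-!
# RootDecomp1ELWTransport — lens 2, generation 39 «LW-PAIR NORM TRANSPORT CELL» (lane E-R18 (a)): S ITSELF on the class `InLWClass` (E-doubled moment curves over a dyadic 2-fold-hyper-Liouville T), engine `algebraicIndependent_lwPt` mod `hLW : LWMeasure` — continuation (RootDecomp1ELWTransport06): §3b the descent identity `NormDescent.aeval_descend` + §4 the explicit member `Tstar = Σ 2^{−a_ν}`: `dyadicHyper₂_Tstar`, `Tstar_transcendental`

(lens-2 g39 `LWTransport.lean` [HOME/decomp-schanuel-lens-2/g39/ sha256 cff5d88d…e8f0, 2208 l; NODE L1907 / REQUEST L1908; critic VERDICT L1909 (CLEARED, E-R18 (a) cell credit, port GO)]; port by census-1 gen 17 as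
`RootDecomp1ELWTransport01`–`09` — see the PORT NOTE of part 01; `--supports stmt-Schanuel-31409`; rung 0.)
-/

noncomputable section

open Complex Polynomial
open Literature.NumberTheory.Transcendental (zlen zlen_nonneg zlen_add_le zlen_monomial_le zlen_sum_le
  zlen_mul_le zlen_pow_le)

namespace Summit.Schanuel.Schanuel.Theorems.RootDecomp1ELWTransport

open Summit.Schanuel.Schanuel.Theorems.RootDecomp1KHyper (SB SFset sb_of_algebraicIndependent LWMeasure
  exists_ball_eval_ne_zero exists_int_mul_eq_map mvaeval_int_map)
open Summit.Schanuel.Schanuel.Theorems.RootDecomp1KHyper.HyperCell (Ewt exC collPoly collPoly_ne_zero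
  exC_inj)
open NormDescent (P2)

variable {k : ℕ}

/-- `x ≤ Real.exp x` (for `(x : ℝ)`). -/
private theorem le_exp_self (x : ℝ) : x ≤ Real.exp x := by linarith [Real.add_one_le_exp x]

/-! ## §3b  The descent identity at the level of polynomials (checklist (2)(i)) -/

namespace NormDescent

/-- `(halve g)(X², Y²) = g` for an even `g` — the polynomial identity behind `aeval_halve_of_even`. -/
theorem aeval_Xsq_halve_of_even {g : P2} (hg : IsEven g) :
    MvPolynomial.aeval (fun i : Fin 2 => (MvPolynomial.X i : P2) ^ 2) (halve g) = g := by
  conv_rhs => rw [← MvPolynomial.support_sum_monomial_coeff g]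
  unfold halve
  rw [map_sum]
  refine Finset.sum_congr rfl fun m hm => ?_
  have hdiv : ∀ i : Fin 2, 2 ∣ m i := fun i => by
    obtain ⟨h0, h1⟩ := hg m hm
    rcases Fin.exists_fin_two.mp ⟨i, rfl⟩ with h | h <;> rw [h] <;> assumption
  rw [MvPolynomial.aeval_monomial, MvPolynomial.monomial_eq, Finsupp.prod_fintype _ _ (by simp),
    Finsupp.prod_fintype _ _ (by simp), eq_intCast, eq_intCast]
  congr 1
  refine Finset.prod_congr rfl fun i _ => ?_
  rw [← pow_mul, half_apply, Nat.mul_div_cancel' (hdiv i)]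

/-- **The norm identity (2)(i):** `(step f)(X², Y²) = f(X,Y)·f(−X,Y)·f(X,−Y)·f(−X,−Y) = quad f`. -/
theorem aeval_Xsq_step (f : P2) :
    MvPolynomial.aeval (fun i : Fin 2 => (MvPolynomial.X i : P2) ^ 2) (step f) = quad f :=
  aeval_Xsq_halve_of_even (isEven_quad f)

end NormDescent

/-! ## §4  Explicit members: `T⋆ = Σ_ν 2^{−a_ν}` -/

/-- The exponent tower: `a₀ = 1`, `a_{ν+1} = a_ν + 1 + 2·3^{2^{ν a_ν}}`. -/
def aSeq : ℕ → ℕ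
  | 0 => 1
  | ν + 1 => aSeq ν + 1 + 2 * 3 ^ 2 ^ (ν * aSeq ν)

/-- `aSeq (ν + 1) = aSeq ν + 1 + 2 * 3 ^ 2 ^ (ν * aSeq ν)` (for `(ν : ℕ)`). -/
theorem aSeq_succ (ν : ℕ) : aSeq (ν + 1) = aSeq ν + 1 + 2 * 3 ^ 2 ^ (ν * aSeq ν) := rfl

/-- `aSeq ν + 1 ≤ aSeq (ν + 1)` (for `(ν : ℕ)`). -/
theorem aSeq_succ_le (ν : ℕ) : aSeq ν + 1 ≤ aSeq (ν + 1) := by rw [aSeq_succ]; omega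

/-- `StrictMono aSeq`. -/
theorem aSeq_strictMono : StrictMono aSeq :=
  strictMono_nat_of_lt_succ fun ν => Nat.lt_of_succ_le (aSeq_succ_le ν)

/-- `ν + 1 ≤ aSeq ν` (for `(ν : ℕ)`). -/
theorem succ_le_aSeq (ν : ℕ) : ν + 1 ≤ aSeq ν := by
  induction ν with
  | zero => simp [aSeq]
  | succ n ih => exact le_trans (by omega) (aSeq_succ_le n)

/-- `aSeq m + i ≤ aSeq (i + m)` (for `(i m : ℕ)`). -/
theorem aSeq_add_le (i m : ℕ) : aSeq m + i ≤ aSeq (i + m) := by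
  induction i with
  | zero => simp
  | succ n ih =>
      calc aSeq m + (n + 1) = aSeq m + n + 1 := by ring
        _ ≤ aSeq (n + m) + 1 := by omega
        _ ≤ aSeq (n + m + 1) := aSeq_succ_le _
        _ = aSeq (n + 1 + m) := by ring_nf

/-- the `i`-th term `2^{−a_i}` -/
def tm (i : ℕ) : ℝ := ((2 : ℝ) ^ aSeq i)⁻¹

/-- `0 < tm i` (for `(i : ℕ)`). -/
theorem tm_pos (i : ℕ) : 0 < tm i := by unfold tm; positivity

/-- `tm i ≤ (1 / 2 : ℝ) ^ i` (for `(i : ℕ)`). -/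
theorem tm_le_geom (i : ℕ) : tm i ≤ (1 / 2 : ℝ) ^ i := by
  unfold tm
  rw [one_div, inv_pow]
  exact inv_anti₀ (by positivity) (pow_le_pow_right₀ one_le_two (by have := succ_le_aSeq i; omega))

/-- `Summable tm`. -/
theorem summable_tm : Summable tm :=
  Summable.of_nonneg_of_le (fun i => (tm_pos i).le) tm_le_geom
    (summable_geometric_of_lt_one (by norm_num) (by norm_num))

/-- **The explicit member** `T⋆ := Σ_{ν ≥ 0} 2^{−a_ν}`. -/
def Tstar : ℝ := ∑' i, tm i

/-- `0 < Tstar`. -/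
theorem Tstar_pos : 0 < Tstar := summable_tm.tsum_pos (fun i => (tm_pos i).le) 0 (tm_pos 0)

/-- numerator of the `m`-th partial sum over the denominator `2^{a_m}` -/
def pnum (m : ℕ) : ℕ := ∑ i ∈ Finset.range (m + 1), 2 ^ (aSeq m - aSeq i)

/-- `∑ i ∈ Finset.range (m + 1), tm i = (pnum m : ℝ) / 2 ^ aSeq m` (for `(m : ℕ)`). -/
theorem partialSum_eq (m : ℕ) :
    ∑ i ∈ Finset.range (m + 1), tm i = (pnum m : ℝ) / 2 ^ aSeq m := by
  unfold pnum
  push_cast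
  rw [Finset.sum_div]
  refine Finset.sum_congr rfl fun i hi => ?_
  have him : aSeq i ≤ aSeq m :=
    aSeq_strictMono.monotone (Nat.lt_succ_iff.mp (Finset.mem_range.mp hi))
  unfold tm
  rw [eq_div_iff (by positivity), inv_mul_eq_div, pow_sub₀ _ (by norm_num : (2 : ℝ) ≠ 0) him]
  simp only [div_eq_mul_inv]

/-- `Summable fun i => tm (i + (m + 1))` (for `(m : ℕ)`). -/
theorem summable_tail (m : ℕ) : Summable fun i => tm (i + (m + 1)) :=
  (summable_nat_add_iff (m + 1)).mpr summable_tm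

/-- `Tstar - (pnum m : ℝ) / 2 ^ aSeq m = ∑' i, tm (i + (m + 1))` (for `(m : ℕ)`). -/
theorem Tstar_sub_partialSum (m : ℕ) :
    Tstar - (pnum m : ℝ) / 2 ^ aSeq m = ∑' i, tm (i + (m + 1)) := by
  rw [← partialSum_eq, Tstar, ← summable_tm.sum_add_tsum_nat_add (m + 1)]
  ring

/-- `0 < ∑' i, tm (i + (m + 1))` (for `(m : ℕ)`). -/
theorem tail_pos (m : ℕ) : 0 < ∑' i, tm (i + (m + 1)) :=
  (summable_tail m).tsum_pos (fun _ => (tm_pos _).le) 0 (tm_pos _)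

/-- `tm (i + (m + 1)) ≤ (1 / 2 : ℝ) ^ i * tm (m + 1)` (for `(m i : ℕ)`). -/
theorem tm_shift_le (m i : ℕ) : tm (i + (m + 1)) ≤ (1 / 2 : ℝ) ^ i * tm (m + 1) := by
  unfold tm
  have h := aSeq_add_le i (m + 1)
  calc ((2 : ℝ) ^ aSeq (i + (m + 1)))⁻¹ ≤ ((2 : ℝ) ^ (aSeq (m + 1) + i))⁻¹ :=
        inv_anti₀ (by positivity) (pow_le_pow_right₀ one_le_two h)
    _ = (1 / 2 : ℝ) ^ i * ((2 : ℝ) ^ aSeq (m + 1))⁻¹ := by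
        rw [pow_add, mul_inv, one_div, inv_pow, mul_comm]

/-- `∑' i, tm (i + (m + 1)) ≤ 2 * tm (m + 1)` (for `(m : ℕ)`). -/
theorem tail_le (m : ℕ) : ∑' i, tm (i + (m + 1)) ≤ 2 * tm (m + 1) := by
  have hs : Summable fun i : ℕ => (1 / 2 : ℝ) ^ i * tm (m + 1) :=
    (summable_geometric_of_lt_one (by norm_num) (by norm_num)).mul_right _
  calc ∑' i, tm (i + (m + 1)) ≤ ∑' i : ℕ, (1 / 2 : ℝ) ^ i * tm (m + 1) :=
        (summable_tail m).tsum_le_tsum (tm_shift_le m) hs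
    _ = (∑' i : ℕ, (1 / 2 : ℝ) ^ i) * tm (m + 1) := tsum_mul_right
    _ = 2 * tm (m + 1) := by rw [tsum_geometric_two]

/-- The numerical heart of membership: `2·2^{−a_{m+1}} < exp(−exp(2^{m a_m}))` (uses `e < 3`, `e < 4`). -/
theorem two_tm_succ_lt (m : ℕ) :
    2 * tm (m + 1) < Real.exp (-Real.exp ((2 : ℝ) ^ (m * aSeq m))) := by
  set E : ℕ := 2 ^ (m * aSeq m) with hE
  set G : ℕ := 3 ^ E with hG
  have haS : aSeq (m + 1) = aSeq m + 1 + 2 * G := by rw [aSeq_succ]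
  have hG0 : G ≠ 0 := by positivity
  have he3 : Real.exp 1 ≤ 3 := by have := Real.exp_one_lt_d9; linarith
  have he4 : Real.exp 1 < 4 := by have := Real.exp_one_lt_d9; linarith
  have h4G : (0 : ℝ) < 4 ^ G := by positivity
  have h1 : 2 * tm (m + 1) ≤ ((4 : ℝ) ^ G)⁻¹ := by
    have hpow : (2 : ℝ) ^ aSeq (m + 1) = 2 ^ aSeq m * 2 * 4 ^ G := by
      rw [haS, pow_add, pow_add, pow_one, pow_mul]; norm_num
    have ham : (1 : ℝ) ≤ 2 ^ aSeq m := one_le_pow₀ one_le_two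
    unfold tm
    rw [hpow, show (2 : ℝ) * (2 ^ aSeq m * 2 * 4 ^ G)⁻¹ = (2 ^ aSeq m)⁻¹ * (4 ^ G)⁻¹ by
      rw [mul_inv, mul_inv]; field_simp]
    calc ((2 : ℝ) ^ aSeq m)⁻¹ * ((4 : ℝ) ^ G)⁻¹ ≤ 1 * ((4 : ℝ) ^ G)⁻¹ :=
          mul_le_mul_of_nonneg_right (inv_le_one_of_one_le₀ ham) (by positivity)
      _ = ((4 : ℝ) ^ G)⁻¹ := one_mul _
  have h2 : Real.exp ((2 : ℝ) ^ (m * aSeq m)) ≤ (G : ℝ) := by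
    have e1 : (2 : ℝ) ^ (m * aSeq m) = (E : ℝ) * 1 := by rw [hE]; push_cast; ring
    rw [e1, Real.exp_nat_mul, hG]
    push_cast
    exact pow_le_pow_left₀ (Real.exp_pos _).le he3 E
  have h3 : Real.exp (G : ℝ) < (4 : ℝ) ^ G := by
    rw [show (G : ℝ) = (G : ℝ) * 1 by ring, Real.exp_nat_mul]
    exact pow_lt_pow_left₀ he4 (Real.exp_pos _).le hG0
  calc 2 * tm (m + 1) ≤ ((4 : ℝ) ^ G)⁻¹ := h1
    _ < (Real.exp (G : ℝ))⁻¹ := (inv_lt_inv₀ h4G (Real.exp_pos _)).mpr h3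
    _ = Real.exp (-(G : ℝ)) := (Real.exp_neg _).symm
    _ ≤ Real.exp (-Real.exp ((2 : ℝ) ^ (m * aSeq m))) := Real.exp_le_exp.mpr (neg_le_neg h2)

/-- **Membership: `T⋆` is dyadic 2-fold hyper-Liouville** (PROVED: dyadic partial sums + tail bound). -/
theorem dyadicHyper₂_Tstar : DyadicHyper₂ Tstar := by
  intro m
  refine ⟨aSeq m, pnum m, (Nat.le_succ m).trans (succ_le_aSeq m), ?_, ?_⟩
  · intro h
    have := tail_pos m
    rw [← Tstar_sub_partialSum, ← h, sub_self] at this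
    exact lt_irrefl _ this
  · rw [Tstar_sub_partialSum, abs_of_pos (tail_pos m)]
    exact (tail_le m).trans_lt (two_tm_succ_lt m)

/-- Dyadic 2-fold hyper-Liouville reals are Liouville numbers … -/
theorem DyadicHyper₂.liouville {T : ℝ} (hT : DyadicHyper₂ T) : Liouville T := by
  intro n
  obtain ⟨μ, p, hμ, hne, hlt⟩ := hT (n + 1)
  refine ⟨p, 2 ^ μ, ?_, ?_, ?_⟩
  · have : (2 : ℤ) ^ 1 ≤ 2 ^ μ := pow_le_pow_right₀ (by norm_num) (by omega)
    linarith
  · push_cast; exact hne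
  · push_cast
    refine hlt.trans_le ?_
    have hX : ((2 : ℝ) ^ μ) ^ n ≤ (2 : ℝ) ^ ((n + 1) * μ) := by
      rw [← pow_mul, mul_comm]
      exact pow_le_pow_right₀ one_le_two (by nlinarith)
    have hXpos : (0 : ℝ) < ((2 : ℝ) ^ μ) ^ n := by positivity
    calc Real.exp (-Real.exp ((2 : ℝ) ^ ((n + 1) * μ))) ≤ Real.exp (-(2 : ℝ) ^ ((n + 1) * μ)) :=
          Real.exp_le_exp.mpr (neg_le_neg (le_exp_self _))
      _ ≤ ((2 : ℝ) ^ ((n + 1) * μ))⁻¹ := by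
          rw [Real.exp_neg]; exact inv_anti₀ (by positivity) (le_exp_self _)
      _ ≤ (((2 : ℝ) ^ μ) ^ n)⁻¹ := inv_anti₀ hXpos hX
      _ = 1 / ((2 : ℝ) ^ μ) ^ n := (one_div _).symm

/-- … hence irrational … -/
theorem DyadicHyper₂.irrational {T : ℝ} (hT : DyadicHyper₂ T) : Irrational T := hT.liouville.irrational

/-- … and transcendental (Liouville's theorem, Mathlib), hypothesis-free. -/
theorem DyadicHyper₂.transcendental {T : ℝ} (hT : DyadicHyper₂ T) : Transcendental ℚ T :=
  fun halg => hT.liouville.transcendental ((IsFractionRing.isAlgebraic_iff ℤ ℚ ℝ).mpr halg)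

/-- `Transcendental ℚ (T : ℂ)` (for `{T : ℝ} (hT : DyadicHyper₂ T)`). -/
theorem DyadicHyper₂.transcendental_complex {T : ℝ} (hT : DyadicHyper₂ T) :
    Transcendental ℚ (T : ℂ) := by
  have h := (transcendental_algebraMap_iff (R := ℚ) (A := ℂ) (algebraMap ℝ ℂ).injective).mpr
    hT.transcendental
  rwa [Complex.coe_algebraMap] at h

/-- `Irrational Tstar`. -/
theorem Tstar_irrational : Irrational Tstar := dyadicHyper₂_Tstar.irrational
/-- `Transcendental ℚ (Tstar : ℂ)`. -/
theorem Tstar_transcendental : Transcendental ℚ (Tstar : ℂ) := dyadicHyper₂_Tstar.transcendental_complex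

end Summit.Schanuel.Schanuel.Theorems.RootDecomp1ELWTransport

end
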